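import Summits.NavierStokesRegularity.NavierStokesRegularity.Theses.LerayQuarterDissipation
import Summits.NavierStokesRegularity.NavierStokesRegularity.Theses.GaldiLiouvilleGate
import Summits.NavierStokesRegularity.NavierStokesRegularity.Theses.TypeIQuarterGate
import Summits.NavierStokesRegularity.NavierStokesRegularity.Theorems.LerayQuarterDissipationFiniteDissipationLiouvilleSliceLSix
import Literature.Analysis.FluidPDE.EnstrophyGronwall
import HarnessLib

/-!
# Crux `FiniteDissipationLiouville` (stmt-NavierStokesRegularity-22144) is IMPLIED by
# `ParabolicGaldiLiouville` (stmt-NavierStokesRegularity-0893): the time-shift bridge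

Theorems file of route `LerayQuarterDissipation` (seat ns-lqd-p1 g2; `--supports` the crux).
Navier–Stokes regularity is NOT proved by anything here; no summit is.

The route text (Novelty, "Delta vs 0893") books the crux FDL and GaldiLiouvilleGate's crux
`ParabolicGaldiLiouville` (stmt-0893; also the residual back end of ns-idea-5's TypeIQuarterGate)
as INCOMPARABLE ("a rate not a uniform bound, no steady members, apex-boundedness not vanishing —
neither implies the other"). One direction of that is false, and this file proves it:

  `ParabolicGaldiLiouville → FiniteDissipationLiouville`,

indeed `ParabolicGaldiLiouville` forces EVERY member of the finite-dissipation stratum to vanish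
(`eq_zero_of_parabolicGaldiLiouville`, the Liouville form, stronger than FDL's regularity form).
The bridge is the time shift `v(t) = ū(t − δ)`, `δ > 0` (KNSS 2009, §1: the symmetries of the
class; tree `IsTypeIAncientMild.comp_sub_right`, `…isBoundedAncientMildSolution_sub`): for a member
`ū` of the stratum (Type-I ancient mild in the KNSS gauge, `∫ ‖∇ū(s)‖² ≤ K/√(−s)`), the shifted
field is a BOUNDED ancient mild solution (`‖v‖ ≤ C/√δ`), smooth on the open past, with UNIFORMLY
bounded enstrophy `∫ |∇v(s)|²_F ≤ 3K/√δ` (the quarter rate evaluated a distance `≥ δ` before the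
apex; Frobenius versus operator norm costs the factor `3`, tree
`ofReal_frobeniusNormSq_le_three_mul_enorm_sq`) and slices in `L⁶` (the lead's
`…Birth.memLp_six_slice`, p582526) — exactly the hypothesis class of `ParabolicGaldiLiouville`,
which then gives `v ≡ 0`, i.e. `ū ≡ 0` on `t < −δ`, for every `δ > 0`.

* `shift_hypotheses` — the four hypotheses of `ParabolicGaldiLiouville` for the shifted field;
* `eq_zero_of_parabolicGaldiLiouville` — 0893 ⇒ every member of the stratum vanishes on the past;
* `finiteDissipationLiouville_of_parabolicGaldiLiouville` (GaldiLiouvilleGate's copy),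
  `finiteDissipationLiouville_of_parabolicGaldiLiouville'` (TypeIQuarterGate's copy, same text),
  `recurrentDissipativeLiouville_of_parabolicGaldiLiouville` — the DAG edges 0893 ⇒ 22144, 22508.

So LQD's attacked conjunct FDL sits BELOW 0893 (as it sits below (L′) = stmt-4050,
`…Links.finiteDissipationLiouville_of_typeIAncientLiouville`): a proof of Galdi's gate closes FDL.

References: Koch–Nadirashvili–Seregin–Šverák, Acta Math. 203 (2009) = arXiv:0709.3599, §1, §6;
G. P. Galdi, An introduction to the mathematical theory of the NSE (steady Liouville problem).
-/

noncomputable section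

-- the summit and its single sub-problem share the name (CONVENTIONS §1), as in every Theorems file
set_option linter.dupNamespace false

namespace Summit.NavierStokesRegularity.NavierStokesRegularity.Theorems.FiniteDissipationLiouville.OfGaldi

open MeasureTheory Set Filter Function
open Literature.Analysis Literature.Analysis.FluidPDE
open scoped ENNReal NNReal

/-- **The shifted member of the stratum satisfies the hypotheses of `ParabolicGaldiLiouville`.**
For `ū` Type-I ancient mild (constant `C`) with the quarter-rate dissipation law (constant `K`) and
`δ > 0`, the field `v(t) = ū(t − δ)` is a bounded ancient mild solution (`ν = 1`), jointly smooth on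
`(−∞,0) × ℝ³`, has uniformly bounded enstrophy `∫ |∇v(s)|²_F ≤ 3K/√δ` (`s < 0`), and every slice
`v(s)`, `s < 0`, lies in `L⁶`. -/
theorem shift_hypotheses {C K : ℝ}
    {u : ℝ → EuclideanSpace ℝ (Fin 3) → EuclideanSpace ℝ (Fin 3)} (hu : IsTypeIAncientMild C u)
    (hlaw : ∀ s : ℝ, s < 0 → ∫⁻ x, ‖fderiv ℝ (u s) x‖ₑ ^ 2 ≤ ENNReal.ofReal (K / Real.sqrt (-s)))
    {δ : ℝ} (hδ : 0 < δ) :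
    IsBoundedAncientMildSolution 1 (fun t => u (t - δ)) ∧
      ContDiffOn ℝ (⊤ : ℕ∞) (uncurry fun t => u (t - δ)) (Iio 0 ×ˢ univ) ∧
      (∃ C' : ℝ≥0, ∀ s < 0,
        ∫⁻ y, ENNReal.ofReal (frobeniusNormSq (fderiv ℝ ((fun t => u (t - δ)) s) y)) ≤ C') ∧
      (∀ s < 0, MemLp ((fun t => u (t - δ)) s) 6 volume) := by
  obtain ⟨CL, -, hL6⟩ := Birth.memLp_six_slice
  refine ⟨hu.isBoundedAncientMildSolution_sub hδ, (hu.comp_sub_right hδ.le).1, ?_,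
    fun s hs => (hL6 C K u hu hlaw (s - δ) (by linarith)).1⟩
  -- the uniform enstrophy bound `3 K/√δ`
  have hB : (3 * ENNReal.ofReal (K / Real.sqrt δ)) ≠ ⊤ :=
    ENNReal.mul_ne_top (by norm_num) ENNReal.ofReal_ne_top
  refine ⟨(3 * ENNReal.ofReal (K / Real.sqrt δ)).toNNReal, fun s hs => ?_⟩
  rw [ENNReal.coe_toNNReal hB]
  have hsd : s - δ < 0 := by linarith
  calc ∫⁻ y, ENNReal.ofReal (frobeniusNormSq (fderiv ℝ (u (s - δ)) y))
      ≤ ∫⁻ y, 3 * ‖fderiv ℝ (u (s - δ)) y‖ₑ ^ 2 :=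
        lintegral_mono fun y => ofReal_frobeniusNormSq_le_three_mul_enorm_sq _
    _ = 3 * ∫⁻ y, ‖fderiv ℝ (u (s - δ)) y‖ₑ ^ 2 := lintegral_const_mul' _ _ (by norm_num)
    _ ≤ 3 * ENNReal.ofReal (K / Real.sqrt (-(s - δ))) := by gcongr; exact hlaw _ hsd
    _ ≤ 3 * ENNReal.ofReal (K / Real.sqrt δ) := by
        refine mul_le_mul_right ?_ 3
        rcases le_or_gt 0 K with hK | hK
        · exact ENNReal.ofReal_le_ofReal
            (div_le_div_of_nonneg_left hK (Real.sqrt_pos.2 hδ) (Real.sqrt_le_sqrt (by linarith)))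
        · rw [ENNReal.ofReal_of_nonpos (div_nonpos_of_nonpos_of_nonneg hK.le (Real.sqrt_nonneg _))]
          exact bot_le

/-- **`ParabolicGaldiLiouville` kills the whole finite-dissipation stratum** (Liouville form): if
Galdi's parabolic gate (stmt-0893) holds, then every Type-I ancient mild field with the quarter-rate
dissipation law vanishes on `t < 0` — apply the gate to the shift `v(t) = ū(t − δ)`
(`shift_hypotheses`) to get `ū ≡ 0` on `t < −δ`, for every `δ > 0`. -/
theorem eq_zero_of_parabolicGaldiLiouville
    (hG : Theses.GaldiLiouvilleGate.ParabolicGaldiLiouville) {C K : ℝ}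
    {u : ℝ → EuclideanSpace ℝ (Fin 3) → EuclideanSpace ℝ (Fin 3)} (hu : IsTypeIAncientMild C u)
    (hlaw : ∀ s : ℝ, s < 0 → ∫⁻ x, ‖fderiv ℝ (u s) x‖ₑ ^ 2 ≤ ENNReal.ofReal (K / Real.sqrt (-s))) :
    ∀ t < 0, ∀ x, u t x = 0 := by
  intro t ht x
  have hδ : 0 < -t / 2 := by linarith
  obtain ⟨hb, hsm, hens, hL6⟩ := shift_hypotheses hu hlaw hδ
  have h := hG (fun s => u (s - -t / 2)) hb hsm hens hL6 (t / 2) (by linarith) x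
  have e : t / 2 - -t / 2 = t := by ring
  rwa [e] at h

/-- **DAG edge stmt-0893 ⇒ stmt-22144**: `ParabolicGaldiLiouville → FiniteDissipationLiouville`
(route GaldiLiouvilleGate's copy of 0893). A vanishing field is bounded at the apex. -/
theorem finiteDissipationLiouville_of_parabolicGaldiLiouville
    (hG : Theses.GaldiLiouvilleGate.ParabolicGaldiLiouville) :
    Theses.LerayQuarterDissipation.FiniteDissipationLiouville := by
  intro C K u hu hlaw hsing
  obtain ⟨t, ht, x, -, hM⟩ := hsing 1 one_pos 0
  rw [eq_zero_of_parabolicGaldiLiouville hG hu hlaw t ht.2 x, norm_zero] at hM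
  exact lt_irrefl 0 hM

/-- The same edge from route TypeIQuarterGate's copy of `ParabolicGaldiLiouville` (stmt-0893,
identical text; ns-idea-5's line C uses it as residual back end). -/
theorem finiteDissipationLiouville_of_parabolicGaldiLiouville'
    (hG : Theses.TypeIQuarterGate.ParabolicGaldiLiouville) :
    Theses.LerayQuarterDissipation.FiniteDissipationLiouville :=
  finiteDissipationLiouville_of_parabolicGaldiLiouville hG

/-- **DAG edge stmt-0893 ⇒ stmt-22508**: `ParabolicGaldiLiouville → RecurrentDissipativeLiouville`
(the child crux is FDL restricted to uniformly recurrent members). -/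
theorem recurrentDissipativeLiouville_of_parabolicGaldiLiouville
    (hG : Theses.GaldiLiouvilleGate.ParabolicGaldiLiouville) :
    Theses.LerayQuarterDissipation.RecurrentDissipativeLiouville :=
  fun C K w hw hD _ => finiteDissipationLiouville_of_parabolicGaldiLiouville hG C K w hw hD

end Summit.NavierStokesRegularity.NavierStokesRegularity.Theorems.FiniteDissipationLiouville.OfGaldi

end
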